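import Mathlib.NumberTheory.NumberField.Units.Basic
import Literature.AlgebraicGeometry.Frobenioids.ArithmeticDivisors
import HarnessLib

/-!
# Frobenioids I, Example 6.3: the kernel of `div : L^× → Φ(L)^gp` is the group of roots of unity

Mochizuki, *The geometry of Frobenioids I: the general theory*, Kyushu J. Math. **62** (2008)
293–400, Example 6.3, kurims text p. 113 [cite: MochizukiFrdI2008, Ex. 6.3 p.113]: for an object `A` of
the arithmetic Frobenioid `C_{F̃/F}` over `Spec(L)`, "`O^×(A) = O^▷(A) = μ(L)` [cf., for instance, [Szp],
p. 15]". In the model Frobenioid of Thm. 5.2 the endomorphisms in `O^▷(A)` are the elements `f` of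
`B(L) = L^×` whose arithmetic divisor `div(f) ∈ Φ(L)^gp` vanishes, so the printed claim is the classical
statement PROVED here over Mathlib (`ArithmeticDivisors.lean` for `div`):

`principalArithDivisor_eq_zero_iff : div(x) = 0 ↔ x` is a root of unity (`IsOfFinOrder x`), `x ∈ L^×`.

Proof as in the classical argument (Kronecker): `div(x) = 0` forces `|x|_v = 1` at every finite place, so
`x` and `x⁻¹` are algebraic integers (`mem_integers_of_valuation_le_one`), and `|x|_w = 1` at every
infinite place, so `x` is torsion in `(𝓞 L)^×` (Mathlib's `NumberField.Units.mem_torsion`); conversely a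
root of unity has torsion, hence zero, divisor in the torsion-free group `Φ(L)^gp`.
No statement of the paper is strengthened.
-/

noncomputable section

namespace Literature.AlgebraicGeometry.Frobenioids

open NumberField IsDedekindDomain

variable {L : Type*} [Field L] [NumberField L]

/-- If `div(x) = 0` then `|x|_w = 1` at every finite place. [cite: MochizukiFrdI2008, Ex. 6.3 p.113] -/
theorem finitePlace_apply_eq_one_of_div_eq_zero {x : Lˣ} (h : principalArithDivisor L x = 0)
    (w : FinitePlace L) : w (x : L) = 1 := by
  rw [apply_eq_one_iff_ordFin_eq_zero, ← principalArithDivisor_fst, h]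
  rfl

/-- If `div(x) = 0` then `|x|_w = 1` at every infinite place. [cite: MochizukiFrdI2008, Ex. 6.3 p.113] -/
theorem infinitePlace_apply_eq_one_of_div_eq_zero {x : Lˣ} (h : principalArithDivisor L x = 0)
    (w : InfinitePlace L) : w (x : L) = 1 := by
  have h2 : -Real.log (w (x : L)) = 0 := by rw [← principalArithDivisor_snd, h]; rfl
  have hpos : 0 < w (x : L) := InfinitePlace.pos_iff.mpr x.ne_zero
  rcases Real.log_eq_zero.mp (neg_eq_zero.mp h2) with h0 | h1 | hm1
  · exact absurd h0 hpos.ne'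
  · exact h1
  · linarith

/-- An element of `L` all of whose finite absolute values are `1` is an algebraic integer
(valuative criterion, Mathlib `mem_integers_of_valuation_le_one`). [cite: MochizukiFrdI2008, Ex. 6.3 p.113] -/
theorem mem_range_algebraMap_of_finitePlace_eq_one {x : L} (h : ∀ w : FinitePlace L, w x = 1) :
    x ∈ (algebraMap (𝓞 L) L).range := by
  refine HeightOneSpectrum.mem_integers_of_valuation_le_one (R := 𝓞 L) L x fun v => le_of_eq ?_
  have h1 : ((WithZeroMulInt.toNNReal (NumberField.HeightOneSpectrum.absNorm_ne_zero v)
      (v.valuation L x) : NNReal) : ℝ) = 1 := by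
    rw [← FinitePlace.norm_embedding', ← FinitePlace.mk_apply]
    exact h (FinitePlace.mk v)
  have h2 : WithZeroMulInt.toNNReal (NumberField.HeightOneSpectrum.absNorm_ne_zero v) (v.valuation L x) =
      WithZeroMulInt.toNNReal (NumberField.HeightOneSpectrum.absNorm_ne_zero v) 1 := by
    rw [map_one]; exact_mod_cast h1
  exact (WithZeroMulInt.toNNReal_strictMono (NumberField.HeightOneSpectrum.one_lt_absNorm_nnreal v)).injective h2

/-- **Example 6.3** ("`O^×(A) = O^▷(A) = μ(L)`", FrdI p. 113; PROVED): for `x ∈ L^×`, the arithmetic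
divisor `div(x)` vanishes iff `x` is a root of unity. [cite: MochizukiFrdI2008, Ex. 6.3 p.113] -/
theorem principalArithDivisor_eq_zero_iff (x : Lˣ) :
    principalArithDivisor L x = 0 ↔ IsOfFinOrder x := by
  constructor
  · intro h
    -- `x` and `x⁻¹` are algebraic integers
    have hfin := finitePlace_apply_eq_one_of_div_eq_zero h
    have hfin' : ∀ w : FinitePlace L, w ((x⁻¹ : Lˣ) : L) = 1 := fun w => by
      rw [Units.val_inv_eq_inv_val, map_inv₀, hfin w, inv_one]
    obtain ⟨a, ha⟩ := mem_range_algebraMap_of_finitePlace_eq_one hfin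
    obtain ⟨b, hb⟩ := mem_range_algebraMap_of_finitePlace_eq_one hfin'
    have hab : a * b = 1 := by
      apply IsFractionRing.injective (𝓞 L) L
      rw [map_mul, ha, hb, map_one, Units.val_inv_eq_inv_val, mul_inv_cancel₀ x.ne_zero]
    let u : (𝓞 L)ˣ := ⟨a, b, hab, by rw [mul_comm]; exact hab⟩
    have hu : Units.map (algebraMap (𝓞 L) L : 𝓞 L →* L) u = x := Units.ext ha
    -- all archimedean absolute values are `1`, so `u` is torsion
    have htors : u ∈ NumberField.Units.torsion L := by
      rw [NumberField.Units.mem_torsion]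
      intro w
      have := infinitePlace_apply_eq_one_of_div_eq_zero h w
      rw [← hu] at this
      exact this
    have hfo : IsOfFinOrder u := (CommGroup.mem_torsion u).mp htors
    rw [← hu]
    exact (Units.map (algebraMap (𝓞 L) L : 𝓞 L →* L)).isOfFinOrder hfo
  · intro h
    obtain ⟨n, hn, hxn⟩ := isOfFinOrder_iff_pow_eq_one.mp h
    have h1 : principalArithDivisorHom L (x ^ n) = 1 := by rw [hxn, map_one]
    rw [map_pow] at h1
    have h2 : n • principalArithDivisor L x = 0 := by
      have := congrArg Multiplicative.toAdd h1
      rwa [toAdd_pow, toAdd_one] at this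
    rcases (smul_eq_zero.mp h2) with h3 | h3
    · exact absurd h3 hn.ne'
    · exact h3

end Literature.AlgebraicGeometry.Frobenioids

end
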